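import Summits.ResolutionOfSingularities.ResolutionOfSingularities.Theorems.WallCutBottom
import Summits.ResolutionOfSingularities.ResolutionOfSingularities.Theorems.WallCutCritical
import Summits.ResolutionOfSingularities.ResolutionOfSingularities.Theorems.ConeCutWalks
import Literature.AlgebraicGeometry.Resolution.WeightedBlowupNoIncrease
import HarnessLib

/-!
# WallCutBottom (2/2) — continuation of `WallCutBottom`: `section Exit` (radial exit, `bottom_run_false`) and
`section Classes` (the kind `IsBottomRunLoss`, `NoBottomRunLossTailsDeep` proved, the located cut iffs).
Same namespace; opens and section variables replayed verbatim (decomp-res-lens-3 g26; split at the tree 400-line cap).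
-/

open MvPolynomial Finset
open Literature.AlgebraicGeometry.Resolution
open Literature.AlgebraicGeometry.Resolution.Hauser2010
open Literature.AlgebraicGeometry.Resolution.PointBlowup
open Literature.AlgebraicGeometry.Resolution.WeightedBlowup (coeff_translate_monomial)
open Summit.ResolutionOfSingularities.ResolutionOfSingularities.Theorems.TightDefectClasses
open Summit.ResolutionOfSingularities.ResolutionOfSingularities.Theorems.TightDefectStrongWalks
open Summit.ResolutionOfSingularities.ResolutionOfSingularities.Theorems.ItineraryCutClasses
open Summit.ResolutionOfSingularities.ResolutionOfSingularities.Theorems.BoundaryLedger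
open Summit.ResolutionOfSingularities.ResolutionOfSingularities.Theorems.ProximityCut
open Summit.ResolutionOfSingularities.ResolutionOfSingularities.Theorems.WallCutRun
open Summit.ResolutionOfSingularities.ResolutionOfSingularities.Theorems.WallCut
open Summit.ResolutionOfSingularities.ResolutionOfSingularities.Theorems.ConeCut (resForm resLayer cone_of_plateau)

namespace Summit.ResolutionOfSingularities.ResolutionOfSingularities.Theorems.WallCutBottom

section Exit

variable {K : Type} [Field K] [DecidableEq K] {q : ℕ} {s₀ : State (Fin 3) K}
variable {hroot : IsRoot q s₀} {W : ForcedWalk q s₀} {t k s m : ℕ} {i l : Fin 3}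

/-- Walls at the end of the run: `r_u(j) = m`, `r_u(l) = 0`, `r_u(i) = k`, `ordZero F_u = q + k + 1`. [new] [folklore] -/
theorem run_walls (B : BottomRun hroot W t k s m i l) :
    ordZero (W.st (t + 1 + k)).F = ((q + k + 1 : ℕ) : ℕ∞) ∧ (W.st (t + 1 + k)).r i = k ∧
      (W.st (t + 1 + k)).r (W.j t) = m ∧ (W.st (t + 1 + k)).r l = 0 := by
  classical
  obtain ⟨hou, her, hri⟩ := bottom_run_data hroot W t k B.hij B.hsm B.hr1 B.ho1 B.hrun B.hsh
  have hj := congrArg (fun f => f (W.j t)) her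
  have hl := congrArg (fun f => f l) her
  simp only [Finsupp.erase_ne B.hij.symm, Finsupp.erase_ne B.hli, Finsupp.single_eq_same, Finsupp.single_apply,
    if_neg B.hlj.symm] at hj hl
  exact ⟨hou, hri, hj, hl⟩

/-- **THE `u_i²`-COEFFICIENT OF THE RESIDUAL FORM (PROVED).**  If the move `u = t + 1 + k` has chart `c ≠ i` and `y` is the
coordinate off `{i, c}`, then `coeff_{2e_i} N_u = κ · b_y^{d'_y − r_y}` with `κ = coeff_{d'} F_u ≠ 0`. [new] [folklore] -/
theorem coeff_resForm_single_two (B : BottomRun hroot W t k s m i l) (hc : W.j (t + 1 + k) ≠ i) {y : Fin 3}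
    (hyi : y ≠ i) (hyc : y ≠ W.j (t + 1 + k)) :
    coeff (Finsupp.single i 2) (resForm W (t + 1 + k) (q + k + 1)) =
      coeff (tok W i t (k + 2)) (W.st (t + 1 + k)).F *
        W.b (t + 1 + k) y ^ (tok W i t (k + 2) y - (W.st (t + 1 + k)).r y) := by
  classical
  obtain ⟨hmem, hdeg⟩ := tok_mem_run B
  obtain ⟨-, hri, -, -⟩ := run_walls B
  unfold ConeCut.resForm ConeCut.resLayer
  rw [PointBlowup.translate_finset_sum, coeff_sum,
    Finset.sum_eq_single_of_mem (tok W i t (k + 2)) (Finset.mem_filter.mpr ⟨hmem, hdeg⟩)]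
  · rw [coeff_translate_monomial, TightCut.TightRepeat.prod_three hc.symm hyi hyc]
    have hEi : ((tok W i t (k + 2) - (W.st (t + 1 + k)).r).update (W.j (t + 1 + k)) 0) i = 2 := by
      rw [ConeCut.update_apply', if_neg hc.symm, Finsupp.tsub_apply, tok_apply_i W B.hij, hri]; omega
    have hEc : ((tok W i t (k + 2) - (W.st (t + 1 + k)).r).update (W.j (t + 1 + k)) 0) (W.j (t + 1 + k)) = 0 := by
      rw [ConeCut.update_apply', if_pos rfl]
    have hEy : ((tok W i t (k + 2) - (W.st (t + 1 + k)).r).update (W.j (t + 1 + k)) 0) y =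
        tok W i t (k + 2) y - (W.st (t + 1 + k)).r y := by
      rw [ConeCut.update_apply', if_neg hyc, Finsupp.tsub_apply]
    rw [hEi, hEc, hEy, Finsupp.single_eq_same, Finsupp.single_apply, if_neg hc.symm, Finsupp.single_apply,
      if_neg hyi.symm]
    simp
  · intro d hd hne
    obtain ⟨hdF, hdo⟩ := Finset.mem_filter.mp hd
    obtain ⟨hle, heq⟩ := cone_class B hdF hdo
    have hlt : d i < k + 2 := lt_of_le_of_ne hle (fun h => hne (heq h))
    rw [coeff_translate_monomial, TightCut.TightRepeat.prod_three hc.symm hyi hyc]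
    have hEi : ((d - (W.st (t + 1 + k)).r).update (W.j (t + 1 + k)) 0) i = d i - k := by
      rw [ConeCut.update_apply', if_neg hc.symm, Finsupp.tsub_apply, hri]
    rw [hEi, Finsupp.single_eq_same, Nat.choose_eq_zero_of_lt (by omega : d i - k < 2)]
    simp

/-- **THE RADIAL EXIT (PROVED).**  Chart `i` with `b_j ≠ 0` after the run (a second total loss through the older wall) is
impossible: `N_u(b·(X − 1)) = N_u(b)·(X − 1)^s = X^k · Q(X)` with `Q(0) = κ·b_j^k ≠ 0`; at `X = 0` the first form
kills `N_u(b)`,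
hence `Q = 0`. [new] [folklore] -/
theorem radial_exit (B : BottomRun hroot W t k s m i l) (hk : 1 ≤ k) (hc : W.j (t + 1 + k) = i)
    (hbj : W.b (t + 1 + k) (W.j t) ≠ 0) (hhom : (resForm W (t + 1 + k) (q + k + 1)).IsHomogeneous s) : False := by
  classical
  obtain ⟨hmem, hdeg⟩ := tok_mem_run B
  obtain ⟨-, hri, hrj, hrl⟩ := run_walls B
  have hjc : W.j t ≠ W.j (t + 1 + k) := by rw [hc]; exact B.hij.symm
  have hlc : l ≠ W.j (t + 1 + k) := by rw [hc]; exact B.hli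
  have hs := B.hs; have hsm := B.hsm; have hm := B.hm
  -- the radial substitution and the two evaluations of `N_u(b·(X − 1))`
  set b := W.b (t + 1 + k) with hb
  have h1 := aeval_C_mul_of_isHomogeneous b (Polynomial.X - 1) hhom
  set S := (W.st (t + 1 + k)).F.support.filter (fun d => d.degree = q + k + 1) with hS
  set cf : (Fin 3 →₀ ℕ) → K := fun d =>
    coeff d (W.st (t + 1 + k)).F * ∏ x, b x ^ (((d - (W.st (t + 1 + k)).r).update (W.j (t + 1 + k)) 0) x) with hcf
  set Q : Polynomial K := ∑ d ∈ S, Polynomial.C (cf d) * Polynomial.X ^ (k + 2 - d i) with hQdef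
  have h2 : aeval (fun x => Polynomial.C (b x) * (Polynomial.X - 1)) (resForm W (t + 1 + k) (q + k + 1)) =
      Polynomial.X ^ k * Q := by
    unfold ConeCut.resForm
    rw [aeval_translate]
    have hg : (fun x => Polynomial.C (b x) * (Polynomial.X - 1) + Polynomial.C (W.b (t + 1 + k) x)) =
        fun x => Polynomial.C (b x) * Polynomial.X := by
      funext x; rw [← hb]; ring
    rw [hg]
    unfold ConeCut.resLayer
    rw [map_sum, hQdef, Finset.mul_sum]
    refine Finset.sum_congr rfl fun d hd => ?_
    obtain ⟨hdF, hdo⟩ := Finset.mem_filter.mp hd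
    obtain ⟨hle, -⟩ := cone_class B hdF hdo
    have hwall : (W.st (t + 1 + k)).r ≤ d := walk_r hroot W (t + 1 + k) d hdF
    have hwi : k ≤ d i := by have := hwall i; rw [hri] at this; exact this
    have hwj : m ≤ d (W.j t) := by have := hwall (W.j t); rw [hrj] at this; exact this
    have hd3 := degree_eq_three B.hij B.hli B.hlj d
    have hE : (((d - (W.st (t + 1 + k)).r).update (W.j (t + 1 + k)) 0)).degree = k + (k + 2 - d i) := by
      rw [degree_eq_three B.hij B.hli B.hlj, ConeCut.update_apply', if_pos hc.symm, ConeCut.update_apply', if_neg hjc,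
        ConeCut.update_apply', if_neg hlc, Finsupp.tsub_apply, Finsupp.tsub_apply, hrj, hrl]
      omega
    rw [aeval_C_mul_monomial, hE, pow_add]
    ring
  -- evaluation at `X = 0`: `N_u(b) = 0`
  have h12 : Polynomial.C (MvPolynomial.eval b (resForm W (t + 1 + k) (q + k + 1))) * (Polynomial.X - 1) ^ s =
      Polynomial.X ^ k * Q := h1.symm.trans h2
  have hA : MvPolynomial.eval b (resForm W (t + 1 + k) (q + k + 1)) = 0 := by
    have h := congrArg (Polynomial.eval 0) h12
    simp only [Polynomial.eval_mul, Polynomial.eval_C, Polynomial.eval_pow, Polynomial.eval_sub, Polynomial.eval_X,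
      Polynomial.eval_one, zero_sub] at h
    rw [zero_pow (by omega), zero_mul] at h
    rcases mul_eq_zero.mp h with h | h
    · exact h
    · exact absurd h (pow_ne_zero _ (neg_ne_zero.mpr one_ne_zero))
  have hQ : Q = 0 := by
    have h : Polynomial.X ^ k * Q = 0 := by rw [← h12, hA, map_zero, zero_mul]
    rcases mul_eq_zero.mp h with h | h
    · exact absurd h (pow_ne_zero _ Polynomial.X_ne_zero)
    · exact h
  -- but `Q(0) = κ · b_j^{k} ≠ 0`
  have hQ0 : Q.coeff 0 = cf (tok W i t (k + 2)) := by
    rw [hQdef, Polynomial.finsetSum_coeff,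
      Finset.sum_eq_single_of_mem (tok W i t (k + 2)) (Finset.mem_filter.mpr ⟨hmem, hdeg⟩)]
    · rw [Polynomial.coeff_C_mul_X_pow, tok_apply_i W B.hij, Nat.sub_self, if_pos rfl]
    · intro d hd hne
      obtain ⟨hdF, hdo⟩ := Finset.mem_filter.mp hd
      obtain ⟨hle, heq⟩ := cone_class B hdF hdo
      have hlt : d i < k + 2 := lt_of_le_of_ne hle (fun h => hne (heq h))
      rw [Polynomial.coeff_C_mul_X_pow, if_neg (by omega)]
  have hc0 : cf (tok W i t (k + 2)) ≠ 0 := by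
    rw [hcf]
    refine mul_ne_zero (mem_support_iff.mp hmem) ?_
    rw [TightCut.TightRepeat.prod_three B.hij B.hli B.hlj, ConeCut.update_apply', if_pos hc.symm, ConeCut.update_apply', if_neg hjc,
      ConeCut.update_apply', if_neg hlc, Finsupp.tsub_apply, Finsupp.tsub_apply, tok_apply_l W B.hli B.hlj, hrl,
      Nat.sub_self, pow_zero, pow_zero, one_mul, mul_one]
    exact pow_ne_zero _ hbj
  rw [← hQ0, hQ, Polynomial.coeff_zero] at hc0
  exact hc0 rfl

/-- **THE BOTTOM-RUN LAW (PROVED; hypothesis-free, port-free; all `q`, all `K`, all shades `s ≥ 3`).**  On a plateau of shade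
`s` (stages `t, …, t + s`), a TOTAL LOSS at `t` from order `≠ q` to the BOTTOM order `q + 1`, followed by `s − 2` untranslated
moves at the origin of one chart `i ≠ j_t`, admits no further move with a dead wall at stage `t + s`: the six exits of §3.
This is the kernel law of the g26 located cut. [new] [folklore] -/
theorem bottom_run_false (hroot : IsRoot q s₀) (W : ForcedWalk q s₀) (t : ℕ) {s : ℕ} (hs3 : 3 ≤ s)
    (hsh : ∀ l', l' ≤ s → (W.st (t + l')).shade = (s : ℕ∞)) (hne : ordZero (W.st t).F ≠ ((q : ℕ) : ℕ∞))
    (hloss : ∀ y, y ≠ W.j t → (W.st (t + 1)).r y = 0) (ho1 : ordZero (W.st (t + 1)).F = ((q + 1 : ℕ) : ℕ∞))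
    (hsw : W.j (t + 1) ≠ W.j t)
    (hrun : ∀ l', l' + 2 < s → W.j (t + 1 + l') = W.j (t + 1) ∧ W.b (t + 1 + l') = 0)
    (hdead : ∃ x, (W.st (t + s)).r x = 0) : False := by
  classical
  obtain ⟨l, hli, hlj⟩ := exists_third hsw
  obtain ⟨m, ho, hsm, hm, hos, hkept, hr1⟩ :=
    bottom_loss_data hroot W t (by have := hsh 0 (by omega); rwa [add_zero] at this) (hsh 1 (by omega)) hloss ho1 hne
  set k := s - 2 with hk
  have hks : s = k + 2 := by omega
  have B : BottomRun hroot W t k s m (W.j (t + 1)) l :=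
    { hij := hsw, hli := hli, hlj := hlj, hs := hks, hsm := hsm, hm := hm, ho := ho, hos := hos, hkept := hkept, hr1 := hr1,
      ho1 := ho1, hrun := fun l' hl' => hrun l' (by omega),
      hsh := fun l' hl' => by have := hsh (1 + l') (by omega); rwa [← add_assoc] at this }
  set i := W.j (t + 1) with hidef
  set u := t + 1 + k with hu
  obtain ⟨hou, hri, hrj, hrl⟩ := run_walls B
  obtain ⟨hmem, hdeg⟩ := tok_mem_run B
  have hκ : coeff (tok W i t (k + 2)) (W.st u).F ≠ 0 := mem_support_iff.mp hmem
  have hshu : (W.st u).shade = (s : ℕ∞) := B.hsh k le_rfl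
  have hshu1 : (W.st (u + 1)).shade = (s : ℕ∞) := by
    have := hsh s le_rfl; rwa [show t + s = u + 1 by omega] at this
  have hhom := (cone_of_plateau hroot W u hou (by omega) (hshu1.trans hshu.symm) hshu).1
  have hcoeff0 : coeff (Finsupp.single i 2) (resForm W u (q + k + 1)) = 0 :=
    hhom.coeff_eq_zero (by rw [Finsupp.degree_single]; omega)
  -- the walls after the move `u`
  have hru1 : ∀ x, (W.st (u + 1)).r x =
      (if x ≠ W.j u ∧ W.b u x = 0 then (W.st u).r x else 0) + if W.j u = x then k + 1 else 0 := by
    intro x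
    rw [r_succ_eq W u hou, Finsupp.add_apply, kept_apply, Finsupp.single_apply, show q + k + 1 - q = k + 1 by omega]
  rw [show t + s = u + 1 by omega] at hdead
  have hpair : ∀ x y : Fin 3, x ≠ y → (W.st (u + 1)).r x + (W.st (u + 1)).r y < q := fun x y hxy =>
    pair_lt_of_isolatedTop (W.isolated (u + 1)) x y hxy (X_pow_mul_X_pow_dvd_of_forall_le (walk_r hroot W (u + 1)) hxy)
  rcases ExitLaw.fin3_cases B.hij B.hli B.hlj (W.j u) with hc | hc | hc
  · -- chart `i`
    by_cases hbj : W.b u (W.j t) = 0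
    · -- pair rule on `(i, j)`: `(k + 1) + m = q`
      have h := hpair i (W.j t) B.hij
      rw [hru1 i, hru1 (W.j t), if_neg (fun h => h.1 hc.symm), if_pos hc, if_pos ⟨by rw [hc]; exact B.hij.symm, hbj⟩,
        if_neg (by rw [hc]; exact B.hij), hrj] at h
      omega
    · exact radial_exit B (by omega) hc hbj hhom
  · -- chart `j`: the `u_i²`-coefficient is `κ ≠ 0`
    have h := coeff_resForm_single_two B (y := l) (by rw [hc]; exact B.hij.symm) B.hli (by rw [hc]; exact B.hlj)
    rw [hcoeff0, tok_apply_l W B.hli B.hlj, hrl, Nat.sub_self, pow_zero, mul_one] at h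
    exact hκ h.symm
  · -- chart `l`
    by_cases hbj : W.b u (W.j t) = 0
    · by_cases hbi : W.b u i = 0
      · -- three positive walls against DEAD
        obtain ⟨x, hx⟩ := hdead
        rw [hru1 x] at hx
        rcases ExitLaw.fin3_cases B.hij B.hli B.hlj x with hxi | hxj | hxl
        · rw [hxi, if_pos ⟨by rw [hc]; exact B.hli.symm, hbi⟩, if_neg (by rw [hc]; exact B.hli), hri] at hx
          omega
        · rw [hxj, if_pos ⟨by rw [hc]; exact B.hlj.symm, hbj⟩, if_neg (by rw [hc]; exact B.hlj), hrj] at hx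
          omega
        · rw [hxl, if_neg (fun h => h.1 hc.symm), if_pos hc] at hx
          omega
      · -- pair rule on `(j, l)`: `m + (k + 1) = q`
        have h := hpair (W.j t) l B.hlj.symm
        rw [hru1 (W.j t), hru1 l, if_pos ⟨by rw [hc]; exact B.hlj.symm, hbj⟩, if_neg (by rw [hc]; exact B.hlj),
          if_neg (fun h => h.1 hc.symm), if_pos hc, hrj] at h
        omega
    · -- the `u_i²`-coefficient is `κ · b_j^{k} ≠ 0`
      have h := coeff_resForm_single_two B (y := W.j t) (by rw [hc]; exact B.hli) B.hij.symm (by rw [hc]; exact B.hlj.symm)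
      rw [hcoeff0] at h
      exact mul_ne_zero hκ (pow_ne_zero _ hbj) h.symm

end Exit

/-! ## §4 THE KIND, THE DECIDED CLASS, THE RE-LOCATED RESIDUAL, THE EXACT CUT -/

section Classes

/-- **THE KIND: a BOTTOM LOSS followed by a FULL STRAIGHT RUN at move `t` (shade `s`).**  The move `t` is a TOTAL LOSS (after it
the newest wall is the only wall), the order right after it is the BOTTOM one `pᵉ + 1` (loss defect `1`), and the next
`s − 2` moves are UNtranslated moves at the origin of ONE chart different from `j_t`.  DEFINITION (the ONE extra binder). -/
def IsBottomRunLoss {K : Type} [Field K] [DecidableEq K] {q : ℕ} {s₀ : State (Fin 3) K} (W : ForcedWalk q s₀)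
    (s t : ℕ) : Prop :=
  (∀ y, y ≠ W.j t → (W.st (t + 1)).r y = 0) ∧ ordZero (W.st (t + 1)).F = ((q + 1 : ℕ) : ℕ∞) ∧
    W.j (t + 1) ≠ W.j t ∧ ∀ l, l + 2 < s → W.j (t + 1 + l) = W.j (t + 1) ∧ W.b (t + 1 + l) = 0

/-- BOTTOM-RUN LOSSY strict tails: the binders of `WallCut.NoLossyStrictTailsDeep` VERBATIM, plus: from the plateau onset `N`
on SOME move is a bottom loss followed by a full straight run.  DECIDED (EMPTY) by the bottom-run law
(`noBottomRunLossTailsDeep_holds`). [new] -/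
def NoBottomRunLossTailsDeep : Prop :=
  ∀ p : ℕ, p.Prime → ∀ e : ℕ, 2 ≤ e → ∀ (K : Type) [Field K] [CharP K p] [PerfectField K] [DecidableEq K]
    (s₀ : State (Fin 3) K), IsRoot (p ^ e) s₀ → ∀ W : ForcedWalk (p ^ e) s₀, (∀ i, 1 ≤ (W.st i).shade) →
    ∀ N : ℕ, (∀ t, N ≤ t → (W.st (t + 1)).shade = (W.st t).shade) →
    (∀ t, N ≤ t → ordZero (W.st t).F ≠ ((p ^ e : ℕ) : ℕ∞)) → (∀ M : ℕ, ∃ t, M ≤ t ∧ StaysOnNewest W t) →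
    (∀ M : ℕ, ∃ t, M ≤ t ∧ W.b t ≠ 0) →
    ∀ s : ℕ, (W.st N).shade = (s : ℕ∞) → 3 ≤ s → p ^ e + 3 ≤ 3 * s → p ^ e + 2 ≤ 2 * s →
    (∀ (k : Fin 3) (N' : ℕ), ∃ t, N' ≤ t ∧ (W.j t = k ∨ W.b t k ≠ 0)) →
    (∀ t, N ≤ t → ((∀ y, (W.st t).r y + 1 ≤ s) ∧ ∃ x, (W.st t).r x = 0 ∧
      ∃ d ∈ (W.st t).F.support, ((d.degree : ℕ) : ℕ∞) = ordZero (W.st t).F ∧ (W.st t).r x < d x)) →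
    (∀ M : ℕ, ∃ t, M ≤ t ∧ ∀ y, y ≠ W.j t → (W.st (t + 1)).r y = 0) →
    (∃ t, N ≤ t ∧ IsBottomRunLoss W s t) → False

/-- OFF-BOTTOM-RUN LOSSY strict tails — THE RE-LOCATED RESIDUAL: the binders of `WallCut.NoLossyStrictTailsDeep` VERBATIM, plus:
from the plateau onset `N` on, NO move is a bottom loss followed by a full straight run (every total loss has defect `≥ 2`,
or is followed within `s − 2` moves by a chart switch or a translated move).  OPEN. [new] -/
def NoLossyOffBottomRunTailsDeep : Prop :=
  ∀ p : ℕ, p.Prime → ∀ e : ℕ, 2 ≤ e → ∀ (K : Type) [Field K] [CharP K p] [PerfectField K] [DecidableEq K]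
    (s₀ : State (Fin 3) K), IsRoot (p ^ e) s₀ → ∀ W : ForcedWalk (p ^ e) s₀, (∀ i, 1 ≤ (W.st i).shade) →
    ∀ N : ℕ, (∀ t, N ≤ t → (W.st (t + 1)).shade = (W.st t).shade) →
    (∀ t, N ≤ t → ordZero (W.st t).F ≠ ((p ^ e : ℕ) : ℕ∞)) → (∀ M : ℕ, ∃ t, M ≤ t ∧ StaysOnNewest W t) →
    (∀ M : ℕ, ∃ t, M ≤ t ∧ W.b t ≠ 0) →
    ∀ s : ℕ, (W.st N).shade = (s : ℕ∞) → 3 ≤ s → p ^ e + 3 ≤ 3 * s → p ^ e + 2 ≤ 2 * s →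
    (∀ (k : Fin 3) (N' : ℕ), ∃ t, N' ≤ t ∧ (W.j t = k ∨ W.b t k ≠ 0)) →
    (∀ t, N ≤ t → ((∀ y, (W.st t).r y + 1 ≤ s) ∧ ∃ x, (W.st t).r x = 0 ∧
      ∃ d ∈ (W.st t).F.support, ((d.degree : ℕ) : ℕ∞) = ordZero (W.st t).F ∧ (W.st t).r x < d x)) →
    (∀ M : ℕ, ∃ t, M ≤ t ∧ ∀ y, y ≠ W.j t → (W.st (t + 1)).r y = 0) →
    (∀ t, N ≤ t → ¬ IsBottomRunLoss W s t) → False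

/-- **THE DECIDED SIDE (PROVED, hypothesis-free, all `pᵉ`): no strict small-dead tail contains a bottom loss followed by a full
straight run** — by the bottom-run law (LOSSY, JOINT, STAYS, translations, `3s ≥ pᵉ + 3`, `pᵉ + 2 ≤ 2s` unused).
[new] [folklore] -/
theorem noBottomRunLossTailsDeep_holds : NoBottomRunLossTailsDeep := by
  intro p hp e he K _ _ _ _ s₀ hroot W hpos N hplat hne hS hb s hsN h3 h33 h22 hcoord hsd hlossy ⟨t, hNt, hloss, ho1, hsw, hrun⟩
  have hconst := WallCutCritical.shade_eq_of_plateau W hplat hsN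
  exact bottom_run_false hroot W t h3 (fun l' _ => hconst (t + l') (by omega)) (hne t hNt) hloss ho1 hsw hrun
    ((hsd (t + s) (by omega)).2.imp fun x hx => hx.1)

/-- **THE EXACT CUT (PROVED, hypothesis-free).**  The located residual `WallCut.NoLossyStrictTailsDeep` is EQUIVALENT to the
conjunction of its bottom-run part and its off-bottom-run part (case split on the ONE extra binder). [new] [folklore] -/
theorem noLossyStrictTailsDeep_iff :
    NoLossyStrictTailsDeep ↔ NoBottomRunLossTailsDeep ∧ NoLossyOffBottomRunTailsDeep := by
  constructor
  · intro h
    exact ⟨fun p hp e he K _ _ _ _ s₀ hroot W hpos N hplat hne hS hb s hsN h3 h33 h22 hcoord hsd hlossy _ =>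
        h p hp e he K s₀ hroot W hpos N hplat hne hS hb s hsN h3 h33 h22 hcoord hsd hlossy,
      fun p hp e he K _ _ _ _ s₀ hroot W hpos N hplat hne hS hb s hsN h3 h33 h22 hcoord hsd hlossy _ =>
        h p hp e he K s₀ hroot W hpos N hplat hne hS hb s hsN h3 h33 h22 hcoord hsd hlossy⟩
  · rintro ⟨hB, hO⟩ p hp e he K _ _ _ _ s₀ hroot W hpos N hplat hne hS hb s hsN h3 h33 h22 hcoord hsd hlossy
    by_cases hk : ∃ t, N ≤ t ∧ IsBottomRunLoss W s t
    · exact hB p hp e he K s₀ hroot W hpos N hplat hne hS hb s hsN h3 h33 h22 hcoord hsd hlossy hk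
    · push Not at hk
      exact hO p hp e he K s₀ hroot W hpos N hplat hne hS hb s hsN h3 h33 h22 hcoord hsd hlossy fun t ht => hk t ht

/-- **THE RE-LOCATION (PROVED, hypothesis-free).**  The located residual IS its off-bottom-run part. [new] [folklore] -/
theorem noLossyStrictTailsDeep_iff_offBottomRun : NoLossyStrictTailsDeep ↔ NoLossyOffBottomRunTailsDeep := by
  rw [noLossyStrictTailsDeep_iff]
  exact ⟨fun h => h.2, fun h => ⟨noBottomRunLossTailsDeep_holds, h⟩⟩

end Classes

end Summit.ResolutionOfSingularities.ResolutionOfSingularities.Theorems.WallCutBottom
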